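import Literature.Probability.LatticeModels.ScaleFrameKernelGeom
import Literature.Probability.LatticeModels.ScaleFrameKernelMarkov
import Literature.Probability.LatticeModels.ScaleFrameQuasiMultLower
import Literature.Probability.LatticeModels.ScaleFrameOuterDatum
import HarnessLib

/-!
# Kesten's kernel on a scale frame: the two-sided bound of one gap term (proved)

Topic `Literature/Probability/LatticeModels` (trunk `StatMech`, family `crit-ising`). The heart of the
cross-ratio bound of the chain kernel of Kesten's ratio-limit scheme (H. Kesten, PTRF 73 (1986), §2,
Lemma (23); D. Basu, A. Sapozhnikov, ECP 22 (2017), §2, eq. (2.9)) on an abstract `ScaleFrame`. Under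
the outside measure `μ = φ^{R'}_{⟨E₁⟩}` of an inner datum `(U', R')` (frame edges `E₁` not touching
`U'`, rim `R'` wired), the mass of the context event "`R' ↔ R` inside `Wo ∖ U'` and `Fo`" on the
off-wired gap datum event of `(X, Y)` (gap annulus `(aM^{m+15}, aM^{m+16})` explored from outside)
is, up to the factors `q/c` above and `q/c⁶` below, the PRODUCT `Θ(o; X, Y) · g₁(U', R')` of a
quantity not depending on the inner datum and the inner arm factor `g₁` of the quasi-multiplicativity
bricks (`ScaleFrame.kernel_term_bounds`): event algebra (`ScaleFrame.gapTerm_mem_iff`), Markov at the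
gap datum (`rcMeasure_real_datumOffT_two_block_bounds`), quasi-multiplicativity of the connection
`R' ↔ Y` inside `(U' ∪ X)ᶜ` (`ScaleFrame.quasiMult_upper/lower`), comparability of the gap datum
probability across environments (`ScaleFrame.outerDatum_prob_comparable`) and independence of the
conditional outer piece from the inner datum (`rcMeasure_real_datumOffT_insideCond_eq`).
Everything is proved; no definitions, no named facts.

## References

* [Kesten1986] H. Kesten, *Probab. Theory Related Fields* 73 (1986) 369–394, §2, Lemma (23).
* [BasuSapozhnikov2017ECP] D. Basu, A. Sapozhnikov, *Electron. Commun. Probab.* 22 (2017) no. 26,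
  §2, eq. (2.9).
-/

noncomputable section

open scoped Classical
open MeasureTheory Finset SimpleGraph
open Literature.Probability.Percolation (BondConfig openConnIn openCrossing explSet explRim explEvent
  mem_explEvent_iff)

namespace Literature.Probability.LatticeModels

namespace ScaleFrame

variable {V : Type*} [Fintype V] [DecidableEq V] (F : ScaleFrame V)

/-- Arithmetic of one gap term: from `t ≤ q u κ`, `u κ ≤ q t`, `c⁵ g₁ g₂ ≤ κ ≤ g₁ g₂`, `c γ ≤ v`,
`c v ≤ γ`, `u γ = ℓ v`, `u ≤ v`, `ℓ ≤ γ` (quantities nonnegative, `0 < c`, `0 ≤ q`) follow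
`t ≤ (q/c) ℓ g₂ g₁` and `c⁶ ℓ g₂ g₁ ≤ q t`. [folklore] -/
theorem gapTerm_arith {q c t u κ g₁ g₂ γ v ℓ : ℝ} (hq : 0 ≤ q) (hc : 0 < c) (hu : 0 ≤ u) (hg₁ : 0 ≤ g₁) (hg₂ : 0 ≤ g₂) (hγ : 0 ≤ γ) (hv : 0 ≤ v) (hℓ : 0 ≤ ℓ)
    (h1 : t ≤ q * u * κ) (h2 : u * κ ≤ q * t) (h3 : κ ≤ g₁ * g₂) (h4 : c ^ 5 * g₁ * g₂ ≤ κ)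
    (h5 : c * γ ≤ v) (h6 : c * v ≤ γ) (h7 : u * γ = ℓ * v) (h8 : u ≤ v) (h9 : ℓ ≤ γ) :
    t ≤ q / c * (ℓ * g₂ * g₁) ∧ c ^ 6 * (ℓ * g₂ * g₁) ≤ q * t := by
  -- `c u ≤ ℓ` and `c ℓ ≤ u`, whether or not `γ` vanishes
  have hcu : c * u ≤ ℓ := by
    rcases hγ.eq_or_lt with hγ0 | hγ0
    · have hv0 : v = 0 := le_antisymm (by nlinarith) hv
      have hu0 : u = 0 := le_antisymm (hv0 ▸ h8) hu
      rw [hu0, mul_zero]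
      exact hℓ
    · refine le_of_mul_le_mul_right ?_ hγ0
      calc c * u * γ = c * (ℓ * v) := by rw [← h7]; ring
        _ = ℓ * (c * v) := by ring
        _ ≤ ℓ * γ := mul_le_mul_of_nonneg_left h6 hℓ
  have hcl : c * ℓ ≤ u := by
    rcases hγ.eq_or_lt with hγ0 | hγ0
    · have hl0 : ℓ = 0 := le_antisymm (hγ0 ▸ h9) hℓ
      rw [hl0, mul_zero]
      exact hu
    · refine le_of_mul_le_mul_right ?_ hγ0
      calc c * ℓ * γ ≤ ℓ * v := by nlinarith [mul_le_mul_of_nonneg_left h5 hℓ]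
        _ = u * γ := h7.symm
  constructor
  · calc t ≤ q * u * κ := h1
      _ ≤ q * u * (g₁ * g₂) := mul_le_mul_of_nonneg_left h3 (mul_nonneg hq hu)
      _ = q / c * (c * u) * (g₁ * g₂) := by field_simp
      _ ≤ q / c * ℓ * (g₁ * g₂) :=
          mul_le_mul_of_nonneg_right (mul_le_mul_of_nonneg_left hcu (div_nonneg hq hc.le))
            (mul_nonneg hg₁ hg₂)
      _ = q / c * (ℓ * g₂ * g₁) := by ring
  · calc c ^ 6 * (ℓ * g₂ * g₁) = (c * ℓ) * (c ^ 5 * g₁ * g₂) := by ring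
      _ ≤ u * κ := mul_le_mul hcl h4 (by positivity) hu
      _ ≤ q * t := h2

/-- The gap datum event read on the frame edges and on the genuine frame edges touching `X`: same
probability under any measure of frame edges (`rcMeasure_real_gapDatum_read` without context event).
[cite: BasuSapozhnikov2017ECP, §2 eq. (2.9)] -/
theorem rcMeasure_real_gapDatum_read' {p q : ℝ} (hp : p ∈ Set.Icc (0 : ℝ) 1) (hq : 0 < q)
    (S : Finset (Sym2 V)) (hS : S ⊆ F.E) (B : Set V) (Rest Blk X Y : Set V) :
    (rcMeasure (fromEdgeSet (↑S : Set (Sym2 V))) p q B).real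
        {ω | ω ∩ (↑F.E : Set (Sym2 V)) ∈ explEvent Rest Blk X Y ∩
          {ω | ∀ r ∈ Y, ∀ r₂ ∈ Y, ∃ v ∈ X \ Rest, ∃ v' ∈ X \ Rest,
            s(v, r) ∈ ω ∧ s(v', r₂) ∈ ω ∧ ω ∈ openConnIn (X \ Rest) v v'}} =
      (rcMeasure (fromEdgeSet (↑S : Set (Sym2 V))) p q B).real
        {ω | ω ∩ (↑(F.E.filter fun e => ¬ e.IsDiag ∧ ∃ v ∈ X, v ∈ e) : Set (Sym2 V)) ∈
          explEvent Rest Blk X Y ∩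
          {ω | ∀ r ∈ Y, ∀ r₂ ∈ Y, ∃ v ∈ X \ Rest, ∃ v' ∈ X \ Rest,
            s(v, r) ∈ ω ∧ s(v', r₂) ∈ ω ∧ ω ∈ openConnIn (X \ Rest) v v'}} := by
  have h := F.rcMeasure_real_gapDatum_read hp hq S hS B Rest Blk X Y Set.univ
  rwa [Set.inter_univ, Set.inter_univ] at h

/-- **The two-sided bound of one gap term of the kernel** (Kesten 1986, proof of Lemma (23);
Basu–Sapozhnikov 2017, eq. (2.9)). Frame with ladder `LadderRSWb p q c a M (m+16+g) 13`; inner datum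
`(U', R')` (radii `< aM^m + η`, `R' ∩ U' = ∅`); outer context: region `Wo ⊇ {good, rad < aM^{m+16+g}}`,
target `R ⊆ Wo ∩ outSet (aM^{m+16}) (aM^{m+16+g})`, event `Fo` (read on the genuine frame edges beyond
radius `aM^{m+16+g}`); gap annulus `(aM^{m+15}, aM^{m+16})` explored from outside with datum `(X, Y)`.
Under the outside measure `μ = φ^{R'}_{⟨E₁⟩}` (`E₁` = genuine frame edges not touching `U'`), the mass
`term` of [datum `(X, Y)` off-wired, read on `E₁`] ∩ [`R' ↔ R` inside `Wo ∖ U'`, read on `E₁`] ∩ `Fo`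
satisfies `term ≤ (q/c) Θ g₁` and `c⁶ Θ g₁ ≤ q term`, where `g₁ = g₁(U', R')` is the inner arm factor
of the quasi-multiplicativity bricks and
`Θ = loc([datum off-wired] ∩ [Fo ∩ outer piece], read on the edges touching X) · g₂(X, Y)` does not
depend on the inner datum (`loc` = free measure of the frame edges not inside `inSet (aM^{m+12})`).
[cite: Kesten1986, §2 Lemma (23)] -/
theorem kernel_term_bounds {p q c a M : ℝ} {m g : ℕ}
    (hp : p ∈ Set.Ico (0 : ℝ) 1) (hq : 1 ≤ q) (hc : 0 < c) (ha : 0 < a) (hM : 4 ≤ M) (hg : 1 ≤ g)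
    (hR : a * M ^ (m + 16 + g) ≤ F.Rmax) (hη : F.η ≤ a)
    (hL : F.LadderRSWb p q c a M (m + 16 + g) 13)
    {U' R' : Set V} (hU' : ∀ v ∈ U', v ∈ F.good ∧ F.rad v < a * M ^ m)
    (hR' : ∀ v ∈ R', v ∈ F.good ∧ F.rad v < a * M ^ m + F.η) (hRU : ∀ r ∈ R', r ∉ U')
    {Wo R : Set V} (hWo : ∀ v : V, v ∈ F.good → F.rad v < a * M ^ (m + 16 + g) → v ∈ Wo)
    (hRR : R ⊆ Wo ∩ F.outSet (a * M ^ (m + 16)) (a * M ^ (m + 16 + g)))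
    (Fo : Set (BondConfig V)) (X Y : Set V) :
    let Rest : Set V := F.outSet (a * M ^ (m + 15)) (a * M ^ (m + 15) * M)
    let Blk : Set V := F.annSet (a * M ^ (m + 15)) (a * M ^ (m + 15) * M)
    let E₁ : Finset (Sym2 V) :=
      (F.E.filter fun e => ¬ e.IsDiag) \ (F.E.filter fun e => ¬ e.IsDiag ∧ ∃ v ∈ U', v ∈ e)
    let TX : Finset (Sym2 V) := F.E.filter fun e => ¬ e.IsDiag ∧ ∃ v ∈ X, v ∈ e
    let D₀ : Finset (Sym2 V) := F.E.filter fun e =>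
      ¬ e.IsDiag ∧ ∀ x ∈ e, x ∈ F.outSet (a * M ^ (m + 16)) (a * M ^ (m + 16 + g))
    let Fo₁ : Set (BondConfig V) := {ω | ω ∩ (↑D₀ : Set (Sym2 V)) ∈ Fo}
    let μ := rcMeasure (fromEdgeSet (↑E₁ : Set (Sym2 V))) p q R'
    let loc := rcMeasure (fromEdgeSet
      (↑(F.E \ F.edgesWithin (F.inSet (a * M ^ (m + 15) / M ^ 3))) : Set (Sym2 V))) p q ∅
    let GdOff : Set (BondConfig V) := explEvent Rest Blk X Y ∩
      {ω | ∀ r ∈ Y, ∀ r₂ ∈ Y, ∃ v ∈ X \ Rest, ∃ v' ∈ X \ Rest,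
        s(v, r) ∈ ω ∧ s(v', r₂) ∈ ω ∧ ω ∈ openConnIn (X \ Rest) v v'}
    let Bout : Set (BondConfig V) := Fo₁ ∩ {ω | ∃ y ∈ Y, ∃ v ∈ X,
      s(v, y) ∈ ω ∩ (↑TX : Set (Sym2 V)) ∧ ω ∩ (↑TX : Set (Sym2 V)) ∈ openCrossing (X ∩ Wo) {v} R}
    let U₁ : Set V := {v | v ∈ F.good ∧ v ∉ U' ∧ F.rad v < a * M ^ (m + 1) * M ^ 6}
    let g₁ := (rcMeasure (fromEdgeSet (↑(F.edgesWithin U₁) : Set (Sym2 V))) p q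
      (R' ∪ {v | a * M ^ (m + 1) * M ^ 6 - F.η ≤ F.rad v})).real
        (openCrossing U₁ R' (U₁ ∩ {v | a * M ^ (m + 1) * M ^ 3 ≤ F.rad v}))
    let U₂ : Set V := {v | v ∉ X ∧ a * M ^ (m + 1) * M ^ 8 < F.rad v}
    let g₂ := (rcMeasure (fromEdgeSet (↑(F.edgesWithin U₂) : Set (Sym2 V))) p q
      (Y ∪ {v | F.rad v ≤ a * M ^ (m + 1) * M ^ 8 + F.η})).real
        (openCrossing U₂ (U₂ ∩ {v | F.rad v ≤ a * M ^ (m + 1) * M ^ 11}) Y)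
    let Θ := loc.real ({ω | ω ∩ (↑TX : Set (Sym2 V)) ∈ GdOff} ∩ Bout) * g₂
    let term := μ.real ({ω | ω ∩ (↑E₁ : Set (Sym2 V)) ∈ GdOff} ∩
      ({ω | ω ∩ (↑E₁ : Set (Sym2 V)) ∈ openCrossing (Wo \ U') R' R} ∩ Fo₁))
    term ≤ q / c * (Θ * g₁) ∧ c ^ 6 * (Θ * g₁) ≤ q * term := by
  intro Rest Blk E₁ TX D₀ Fo₁ μ loc GdOff Bout U₁ g₁ U₂ g₂ Θ term
  have hp' : p ∈ Set.Icc (0 : ℝ) 1 := ⟨hp.1, hp.2.le⟩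
  have hq0 : 0 < q := one_pos.trans_le hq
  haveI := isProbabilityMeasure_rcMeasure (fromEdgeSet (↑E₁ : Set (Sym2 V))) hp' hq0 R'
  haveI := isProbabilityMeasure_rcMeasure (fromEdgeSet
    (↑(F.E \ F.edgesWithin (F.inSet (a * M ^ (m + 15) / M ^ 3))) : Set (Sym2 V))) hp' hq0 ∅
  have hE₁E : E₁ ⊆ F.E := Finset.sdiff_subset.trans (Finset.filter_subset _ _)
  have hTXE : TX ⊆ F.E := Finset.filter_subset _ _
  -- everything vanishes unless the datum `(X, Y)` is realised by a configuration of frame edges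
  by_cases hreal : ∃ ω₀ : BondConfig V, ω₀ ⊆ ↑F.E ∧ explSet Rest Blk ω₀ = X ∧ explRim Rest Blk ω₀ = Y
  swap
  · push Not at hreal
    have h0 : ∀ {S : Finset (Sym2 V)}, S ⊆ F.E → {ω : BondConfig V | ω ∩ (↑S : Set (Sym2 V)) ∈ GdOff} = ∅ :=
      fun hS => Set.eq_empty_of_forall_notMem fun ω hω =>
        hreal (ω ∩ _) (Set.inter_subset_right.trans (Finset.coe_subset.2 hS))
          (mem_explEvent_iff.1 hω.1).1 (mem_explEvent_iff.1 hω.1).2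
    have ht0 : term = 0 := by
      show μ.real _ = 0
      rw [h0 hE₁E, Set.empty_inter, measureReal_empty]
    have hΘ0 : Θ = 0 := by
      show loc.real _ * g₂ = 0
      rw [h0 hTXE, Set.empty_inter, measureReal_empty, zero_mul]
    rw [ht0, hΘ0]
    simp
  obtain ⟨ω₀, hω₀, hX, hY⟩ := hreal
  obtain ⟨hRestX, hXRB, hYrad, hYX, hYU', hnX, hXU', hXin, hR'X, hband, hU1eq, hU2eq⟩ :=
    F.gap_datum_facts ha hM hR hη hU' hR' hω₀ hX hY
  obtain ⟨hs1, hs2, -, hs4, -, hs6, hbpos⟩ := F.gap_scales ha hM hR hη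
  have hηpos := F.η_pos
  have hM0 : M ≠ 0 := by positivity
  have hbM : a * M ^ (m + 15) * M ≤ F.Rmax := by rw [hs4]; exact hs6
  -- edge sets
  have hTXE₁ : TX ⊆ E₁ := fun e he => by
    obtain ⟨heE, hnd, v, hvX, hve⟩ := Finset.mem_filter.1 he
    refine Finset.mem_sdiff.2 ⟨Finset.mem_filter.2 ⟨heE, hnd⟩, fun hT => ?_⟩
    obtain ⟨-, -, u, huU, hue⟩ := Finset.mem_filter.1 hT
    exact hXU' e heE ⟨v, hvX, hve⟩ u hue huU
  have hedge₁ : ∀ i, @edgeFinset V (fromEdgeSet (↑E₁ : Set (Sym2 V))) i = E₁ := fun i =>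
    Finset.ext fun e => by
      rw [mem_edgeFinset_fromEdgeSet_iff]
      exact ⟨fun h => h.1, fun h => ⟨h, (Finset.mem_filter.1 (Finset.mem_sdiff.1 h).1).2⟩⟩
  have hT₁ : ∀ i, ∀ e, e ∈ TX ↔
      e ∈ @edgeFinset V (fromEdgeSet (↑E₁ : Set (Sym2 V))) i ∧ ∃ v ∈ X, v ∈ e := fun i e => by
    rw [hedge₁ i]
    exact ⟨fun h => ⟨hTXE₁ h, (Finset.mem_filter.1 h).2.2⟩, fun h =>
      Finset.mem_filter.2 ⟨hE₁E h.1, (Finset.mem_filter.1 (Finset.mem_sdiff.1 h.1).1).2, h.2⟩⟩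
  have hT₂ : ∀ i, ∀ e, e ∈ TX ↔ e ∈ @edgeFinset V (fromEdgeSet
      (↑(F.E \ F.edgesWithin (F.inSet (a * M ^ (m + 15) / M ^ 3))) : Set (Sym2 V))) i ∧
        ∃ v ∈ X, v ∈ e := fun i e => by
    rw [mem_edgeFinset_fromEdgeSet_iff, Finset.mem_sdiff]
    constructor
    · intro h
      obtain ⟨heE, hnd, hv⟩ := Finset.mem_filter.1 h
      exact ⟨⟨⟨heE, hXin e heE hv⟩, hnd⟩, hv⟩
    · rintro ⟨⟨⟨heE, -⟩, hnd⟩, hv⟩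
      exact Finset.mem_filter.2 ⟨heE, hnd, hv⟩
  have hD₀TX : (↑D₀ : Set (Sym2 V)) ⊆ ↑TX := fun e he => by
    obtain ⟨heE, hnd, hall⟩ := Finset.mem_filter.1 (Finset.mem_coe.1 he)
    exact Finset.mem_coe.2 (Finset.mem_filter.2 ⟨heE, hnd, e.out.1,
      hRestX (F.outSet_far_subset_rest ha hM hg (hall _ (Sym2.out_fst_mem e))), Sym2.out_fst_mem e⟩)
  -- `Bout` is read on `TX`
  have hBout : ∀ ω₁ ω₂ : BondConfig V, ω₁ ∩ ↑TX = ω₂ ∩ ↑TX → (ω₁ ∈ Bout ↔ ω₂ ∈ Bout) := by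
    intro ω₁ ω₂ h
    have hTD : (↑TX : Set (Sym2 V)) ∩ ↑D₀ = ↑D₀ := Set.inter_eq_right.2 hD₀TX
    have hD : ω₁ ∩ (↑D₀ : Set (Sym2 V)) = ω₂ ∩ ↑D₀ := by
      rw [← hTD, ← Set.inter_assoc, h, Set.inter_assoc]
    show ω₁ ∩ (↑D₀ : Set (Sym2 V)) ∈ Fo ∧ _ ↔ ω₂ ∩ (↑D₀ : Set (Sym2 V)) ∈ Fo ∧ _
    rw [hD, Set.mem_setOf_eq, Set.mem_setOf_eq, h]
  -- the inner crossing, read off `TX`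
  have hW : ∀ v ∈ {v : V | v ∉ U' ∧ v ∉ X}, v ∈ F.good ∧ F.rad v < a * M ^ (m + 1) * M ^ 15 :=
    fun v hv => ⟨(hnX v hv.2).1, by
      calc F.rad v < a * M ^ (m + 15) * M := (hnX v hv.2).2
        _ = a * M ^ (m + 1) * M ^ 15 := by ring⟩
  have hset : {ω : BondConfig V | ω ∩ (↑E₁ : Set (Sym2 V)) ∈ GdOff} ∩
        ({ω | ω ∩ (↑E₁ : Set (Sym2 V)) ∈ openCrossing (Wo \ U') R' R} ∩ Fo₁) =
      {ω : BondConfig V | ω ∩ (↑TX : Set (Sym2 V)) ∈ GdOff} ∩ Bout ∩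
        {ω | ω ∩ (↑(E₁ \ TX) : Set (Sym2 V)) ∈ openCrossing {v | v ∉ U' ∧ v ∉ X} R' Y} :=
    Set.ext fun ω => by
      simp only [Finset.coe_sdiff]
      exact F.gapTerm_mem_iff ha hM hg hR hη hU' hR' hRU hWo hRR Fo₁ (Finset.coe_subset.2 hTXE₁)
        (fun e he hv => Finset.mem_coe.2 (Finset.mem_filter.2 ⟨hE₁E (Finset.mem_coe.1 he),
          (Finset.mem_filter.1 (Finset.mem_sdiff.1 (Finset.mem_coe.1 he)).1).2, hv⟩))
        (fun e he => (Finset.mem_filter.1 (Finset.mem_coe.1 he)).2.2) hω₀ hX hY ω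
  -- (2) Markov at the gap datum
  have hM4 := rcMeasure_real_datumOffT_two_block_bounds (fromEdgeSet (↑E₁ : Set (Sym2 V))) hp' hq
    R' Rest Blk X Y hR'X TX (hT₁ _) Bout hBout
    {ω | ω ∩ (↑(E₁ \ TX) : Set (Sym2 V)) ∈ openCrossing {v | v ∉ U' ∧ v ∉ X} R' Y}
    (fun ω₁ ω₂ h => by
      rw [hedge₁] at h
      simp only [Set.mem_setOf_eq, h])
  simp only [hedge₁] at hM4
  obtain ⟨hM4a, hM4b⟩ := hM4
  -- (3) the outside measure of the gap datum is the quasi-multiplicativity measure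
  have hν : (rcMeasure (fromEdgeSet (↑(E₁ \ TX) : Set (Sym2 V))) p q (Y ∪ R')).real
      {ω | ω ∩ (↑(E₁ \ TX) : Set (Sym2 V)) ∈ openCrossing {v | v ∉ U' ∧ v ∉ X} R' Y} =
      (rcMeasure (fromEdgeSet (↑(F.edgesWithin {v | v ∉ U' ∧ v ∉ X}) : Set (Sym2 V))) p q
        (R' ∪ Y)).real (openCrossing {v | v ∉ U' ∧ v ∉ X} R' Y) := by
    have h1 := rcMeasure_real_read_self hp' hq0 (E₁ \ TX) (Y ∪ R')
      (openCrossing {v | v ∉ U' ∧ v ∉ X} R' Y) Set.univ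
    rw [Set.inter_univ, Set.inter_univ] at h1
    have hG : fromEdgeSet (↑(E₁ \ TX) : Set (Sym2 V)) =
        fromEdgeSet (↑(F.edgesWithin {v | v ∉ U' ∧ v ∉ X}) : Set (Sym2 V)) :=
      F.fromEdgeSet_gap_inner_eq U' X
    rw [h1, rcMeasure_congr_graph hG p q (Y ∪ R'), Set.union_comm]
  rw [hν] at hM4a hM4b
  -- (4) quasi-multiplicativity of `R' ↔ Y` inside `(U' ∪ X)ᶜ`
  have hR'W : R' ⊆ {v : V | v ∉ U' ∧ v ∉ X} := fun r hr => ⟨hRU r hr, hR'X r hr⟩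
  have hYW : Y ⊆ {v : V | v ∉ U' ∧ v ∉ X} := fun y hy => ⟨hYU' y hy, hYX y hy⟩
  have hR'a : ∀ v ∈ R', F.rad v ≤ a * M ^ (m + 1) := fun v hv => by linarith [(hR' v hv).2]
  have hYa : ∀ v ∈ Y, a * M ^ (m + 1) * M ^ 14 - F.η < F.rad v := fun v hv => by
    rw [hs2]; exact (hYrad v hv).2.1
  have hR15 : a * M ^ (m + 1) * M ^ 15 ≤ F.Rmax := by
    calc a * M ^ (m + 1) * M ^ 15 = a * M ^ (m + 15) * M := by ring
      _ ≤ F.Rmax := hbM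
  have hηa : F.η ≤ a * M ^ (m + 1) :=
    hη.trans (le_mul_of_one_le_right ha.le (one_le_pow₀ (by linarith)))
  have ha' : 0 < a * M ^ (m + 1) := by positivity
  have hL14 : F.LadderRSWb p q c (a * M ^ (m + 1)) M 14 13 :=
    ScaleFrame.LadderRSWb.mono F (ScaleFrame.LadderRSWb.shift F hL (m + 1) (by omega)) (by omega)
  have hqmU := F.quasiMult_upper hp hq ha' hM hR15 hηa {v | v ∉ U' ∧ v ∉ X} R' Y hW hR'W hYW hR'a hYa
  have hqmL := F.quasiMult_lower hp hq hc ha' hM hR15 hηa hL14 {v | v ∉ U' ∧ v ∉ X} R' Y hW hR'W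
    hYW hband hR'a hYa
  simp only at hqmU hqmL
  rw [hU1eq, hU2eq] at hqmU hqmL
  -- (5) the gap datum probability is comparable to its free local probability
  have hdiv1 : a * M ^ (m + 15) / M = a * M ^ (m + 14) := by field_simp; ring
  have hdiv2 : a * M ^ (m + 15) / M ^ 2 = a * M ^ (m + 13) := by field_simp; ring
  have hdiv3 : a * M ^ (m + 15) / M ^ 3 = a * M ^ (m + 12) := by field_simp; ring
  have hdiv4 : a * M ^ (m + 15) / M ^ 4 = a * M ^ (m + 11) := by field_simp; ring
  have h1_11 : a * M ^ (m + 1) ≤ a * M ^ (m + 11) := scale_mono ha hM (by omega)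
  have h1_12 : a * M ^ (m + 1) ≤ a * M ^ (m + 12) := scale_mono ha hM (by omega)
  have hηb : F.η ≤ a * M ^ (m + 15) / M ^ 4 := by rw [hdiv4]; exact hηa.trans h1_11
  have hNC : F.NoCrossBound p q c (a * M ^ (m + 15) / M ^ 2) (a * M ^ (m + 15) / M) := by
    rw [hdiv2, hdiv1]
    exact ScaleFrame.LadderRSWb.noCrossBound F hL (by norm_num) (i := m + 13) (by omega)
  have hBenv : ∀ v ∈ R', v ∈ F.good ∧ F.rad v ≤ a * M ^ (m + 15) / M ^ 4 := fun v hv =>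
    ⟨(hR' v hv).1, by rw [hdiv4]; linarith [(hR' v hv).2]⟩
  have hEenv1 : F.E \ F.edgesWithin (F.inSet (a * M ^ (m + 15) / M ^ 3)) ⊆
      F.E \ (F.E.filter fun e => ¬ e.IsDiag ∧ ∃ v ∈ U', v ∈ e) := by
    intro e he
    rw [Finset.mem_sdiff] at he ⊢
    refine ⟨he.1, fun hT => he.2 ?_⟩
    obtain ⟨heE, -, u, huU, hue⟩ := Finset.mem_filter.1 hT
    rw [F.mem_edgesWithin]
    refine ⟨heE, fun x hx => ?_⟩
    obtain ⟨hxg, hxr⟩ := F.adj_good e heE u hue x hx (hU' u huU).1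
      (by linarith [(hU' u huU).2, hs6, scale_mono ha hM (show m + 1 ≤ m + 16 by omega)])
    refine ⟨hxg, ?_⟩
    rw [hdiv3]
    linarith [(abs_lt.1 hxr).2, (hU' u huU).2]
  have hod := F.outerDatum_prob_comparable hp hq hc hbpos hM hbM hηb hNC X Y hRestX hXRB hYrad
    (F.E \ (F.E.filter fun e => ¬ e.IsDiag ∧ ∃ v ∈ U', v ∈ e)) R' hEenv1 Finset.sdiff_subset hBenv
  simp only at hod
  have hG1 : fromEdgeSet (↑(F.E \ (F.E.filter fun e => ¬ e.IsDiag ∧ ∃ v ∈ U', v ∈ e)) :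
      Set (Sym2 V)) = fromEdgeSet (↑E₁ : Set (Sym2 V)) := fromEdgeSet_sdiff_eq F.E _
  rw [rcMeasure_congr_graph hG1 p q R', F.rcMeasure_real_gapDatum_read' hp' hq0 E₁ hE₁E R' _ _ X Y,
    F.rcMeasure_real_gapDatum_read' hp' hq0 _ Finset.sdiff_subset ∅ _ _ X Y] at hod
  obtain ⟨hod1, hod2⟩ := hod
  -- (6) the conditional outer piece does not depend on the inner datum
  have hM3 := rcMeasure_real_datumOffT_insideCond_eq (fromEdgeSet (↑E₁ : Set (Sym2 V)))
    (fromEdgeSet (↑(F.E \ F.edgesWithin (F.inSet (a * M ^ (m + 15) / M ^ 3))) : Set (Sym2 V)))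
    hp' hq0 R' ∅ Rest Blk X Y hR'X (fun b hb => (Set.notMem_empty b hb).elim) TX (hT₁ _) (hT₂ _)
    Bout hBout
  simp only at hM3
  -- (7) arithmetic
  have h8 : μ.real ({ω : BondConfig V | ω ∩ (↑TX : Set (Sym2 V)) ∈ GdOff} ∩ Bout) ≤
      μ.real {ω : BondConfig V | ω ∩ (↑TX : Set (Sym2 V)) ∈ GdOff} :=
    measureReal_mono Set.inter_subset_left (measure_ne_top _ _)
  have h9 : loc.real ({ω : BondConfig V | ω ∩ (↑TX : Set (Sym2 V)) ∈ GdOff} ∩ Bout) ≤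
      loc.real {ω : BondConfig V | ω ∩ (↑TX : Set (Sym2 V)) ∈ GdOff} :=
    measureReal_mono Set.inter_subset_left (measure_ne_top _ _)
  exact gapTerm_arith hq0.le hc measureReal_nonneg measureReal_nonneg measureReal_nonneg
    measureReal_nonneg measureReal_nonneg measureReal_nonneg ((congrArg μ.real hset).trans_le hM4a) (hM4b.trans_eq (by rw [← hset])) hqmU hqmL
    hod1 hod2 hM3 h8 h9

end ScaleFrame

end Literature.Probability.LatticeModels

end
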